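import Literature.InformationTheory.QuantumCodes.RotatedSurfaceCodeLiftZ
import Mathlib.Combinatorics.SimpleGraph.Paths
import HarnessLib

/-!
# Rough-to-rough self-avoiding paths of the `H_Z` sector of the rotated surface code: their qubits, syndrome-freeness,
# length `≥ L`, and the extraction of one from an odd row-`0` crossing (DKLP §5.3, relative version, rotated layout, `H_Z`)

Topic `Literature/InformationTheory/QuantumCodes` (venture QEC, rung Q5, row 09; qec-type-09 gen 6, second lift for the
`H_Z` sector of `RSC(L)`, every `L`). All PROVED, kernel axioms, no named fact. Continues `RotatedSurfaceCodeLiftZ.lean` (the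
`Z`-check graph of `RSC(L)` as the square lattice: `zsite`, `zbond`, `vbotZ`, `vtopZ`, the hand-shaking lemma); this is the
verbatim twin of `RotatedSurfaceCodeCrossingPaths.lean` (the `H_X` sector), with rows in place of columns:

* `zPathEdge`, `IsZCrossing`, `zPathQubits` — a rough-to-rough lattice path coded by its bottom virtual site `vbotZ b₀` and a
  vertex function `ω ∈ SAW.Zd.saws 2 n`: its `n` bonds are `Z`-bonds of qubits and it ends at a top virtual site `vtopZ b₁`;
  `zPathQubits` = those `n` qubits (`card_zPathQubits`), a chain WITHOUT `Z`-syndrome (`HZ_mulVec_zPathQubits`) and with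
  `n ≥ L` (`le_length_of_isZCrossing`);
* ★ `rsc_existsZ_crossing_subset` — for `L ≥ 2`, a cycle of the `H_Z` sector with an odd number of row-`0` qubits contains a
  rough-to-rough self-avoiding path whose qubits lie in any set supporting it.

## References

* [DennisEtAl2002] E. Dennis, A. Kitaev, A. Landahl, J. Preskill, *Topological quantum memory*, J. Math. Phys. 43 (2002)
  4452–4505, arXiv:quant-ph/0110143, §3.2 (rough edges), §5.2 ("homologically nontrivial (self-avoiding) path must contain at
  least L links"), §5.3 (relative polygons of planar codes).
* [MadrasSlade1993] N. Madras, G. Slade, *The Self-Avoiding Walk*, Birkhäuser 1993, §1.1.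
-/

namespace Literature.InformationTheory.QuantumCodes

namespace RotatedSurface

open Finset Matrix
open Literature.Probability.LatticeModels (Site zdGraph)
open Literature.Probability.Percolation (BondConfig openGraph openGraph_adj)
open Literature.Probability.RandomPlanarGeometry.SAW.Zd (saws mem_saws zdGraph_adj_iff_sub zdGraph_adj_sub_right)

variable {L : ℕ}

/-! ### Coordinates of the virtual ends -/

/-- The bottom virtual sites of the `H_Z` sector lie on the diagonal `u - v = -1`. [cite: DennisEtAl2002, §3.2 (one rough edge)] -/
theorem vbotZ_sub (i : Fin L) : vbotZ i 0 - vbotZ i 1 = -1 := by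
  unfold vbotZ spt
  split_ifs with h <;> simp only [Matrix.cons_val_zero, Matrix.cons_val_one] <;> omega

/-- The top virtual sites of the `H_Z` sector lie on the diagonal `u - v = L - 1` (`L ≥ 1`). [cite: DennisEtAl2002, §3.2 (the opposite rough edge)] -/
theorem vtopZ_sub (hL : 1 ≤ L) (i : Fin L) : vtopZ i 0 - vtopZ i 1 = (L : ℤ) - 1 := by
  unfold vtopZ spt
  split_ifs with h <;> simp only [Matrix.cons_val_zero, Matrix.cons_val_one] <;> omega

/-- A nearest-neighbour walk changes `u - v` by at most one per step: `|ω(i)₀ - ω(i)₁| ≤ i` from the origin. [folklore] -/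
private theorem abs_sub_coord_leZ {ω : ℕ → Site 2} {n : ℕ} (h0 : ω 0 = 0)
    (hadj : ∀ i < n, (zdGraph 2).Adj (ω i) (ω (i + 1))) : ∀ i ≤ n, |ω i 0 - ω i 1| ≤ (i : ℤ) := by
  intro i
  induction i with
  | zero => intro _; simp [h0]
  | succ i ih =>
    intro hi
    have hprev := ih (by omega)
    obtain ⟨k, hk | hk⟩ := (zdGraph_adj_iff_sub _ _).1 (hadj i (by omega))
    · have e0 := congrFun hk 0
      have e1 := congrFun hk 1
      simp only [Pi.sub_apply] at e0 e1
      fin_cases k <;> simp at e0 e1 <;> push_cast <;> rw [abs_le] at hprev ⊢ <;> omega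
    · have e0 := congrFun hk 0
      have e1 := congrFun hk 1
      simp only [Pi.sub_apply] at e0 e1
      fin_cases k <;> simp at e0 e1 <;> push_cast <;> rw [abs_le] at hprev ⊢ <;> omega

/-! ### Rough-to-rough lattice paths -/

/-- The `i`-th bond `{vbotZ b₀ + ω(i), vbotZ b₀ + ω(i+1)}` of the path from the bottom virtual site `vbotZ b₀` following `ω`.
[cite: DennisEtAl2002, §5.3 (relative polygons stretching from one edge to the opposite edge)] -/
def zPathEdge (b₀ : Fin L) (ω : ℕ → Site 2) (i : ℕ) : Sym2 (Site 2) :=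
  s(vbotZ b₀ + ω i, vbotZ b₀ + ω (i + 1))

/-- **A rough-to-rough path of `RSC(L)`** (`n` steps from `vbotZ b₀` along `ω`): its bonds are bonds of qubits and it ends at a
top virtual site. [cite: DennisEtAl2002, §5.3 (relative polygon, endpoints on the boundary)] -/
def IsZCrossing (L : ℕ) (b₀ : Fin L) (n : ℕ) (ω : ℕ → Site 2) : Prop :=
  (∀ i < n, ∃ q : Fin L × Fin L, zbond q = zPathEdge b₀ ω i) ∧ ∃ b₁ : Fin L, vbotZ b₀ + ω n = vtopZ b₁

open Classical in
/-- The qubits whose bonds are the first `n` bonds of the path. [cite: DennisEtAl2002, §5.2 (the links of the path)] -/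
noncomputable def zPathQubits (b₀ : Fin L) (n : ℕ) (ω : ℕ → Site 2) : Finset (Fin L × Fin L) :=
  univ.filter fun q => ∃ i < n, zbond q = zPathEdge b₀ ω i

/-- The bonds of a self-avoiding path are pairwise distinct. [cite: MadrasSlade1993, §1.1] -/
theorem zPathEdge_injOn {n : ℕ} {ω : ℕ → Site 2} (hω : ω ∈ saws 2 n) (b₀ : Fin L) :
    Set.InjOn (zPathEdge b₀ ω) (Finset.range n : Set ℕ) := by
  obtain ⟨-, -, -, hinj⟩ := mem_saws.1 hω
  intro i hi j hj h
  simp only [Finset.coe_range, Set.mem_Iio] at hi hj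
  simp only [zPathEdge, Sym2.eq_iff, add_right_inj] at h
  rcases h with ⟨h1, -⟩ | ⟨h1, h2⟩
  · exact hinj (show i ≤ n by omega) (show j ≤ n by omega) h1
  · have hi' := hinj (show i ≤ n by omega) (show j + 1 ≤ n by omega) h1
    have hj' := hinj (show i + 1 ≤ n by omega) (show j ≤ n by omega) h2
    omega

open Classical in
/-- The bond map carries `zPathQubits` onto the bonds of the path. [cite: DennisEtAl2002, §5.2] -/
theorem image_zbond_zPathQubits {b₀ : Fin L} {n : ℕ} {ω : ℕ → Site 2} (hX : IsZCrossing L b₀ n ω) :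
    (zPathQubits b₀ n ω).image zbond = (Finset.range n).image (zPathEdge b₀ ω) := by
  ext e
  simp only [Finset.mem_image, zPathQubits, Finset.mem_filter, Finset.mem_univ, true_and, Finset.mem_range]
  constructor
  · rintro ⟨q, ⟨i, hi, hq⟩, rfl⟩
    exact ⟨i, hi, hq.symm⟩
  · rintro ⟨i, hi, rfl⟩
    obtain ⟨q, hq⟩ := hX.1 i hi
    exact ⟨q, ⟨i, hi, hq⟩, hq⟩

open Classical in
/-- **A crossing self-avoiding path with `n` steps uses exactly `n` qubits.** [cite: DennisEtAl2002, §5.2 (H links)] -/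
theorem card_zPathQubits {b₀ : Fin L} {n : ℕ} {ω : ℕ → Site 2} (hω : ω ∈ saws 2 n) (hX : IsZCrossing L b₀ n ω) :
    (zPathQubits b₀ n ω).card = n := by
  rw [← Finset.card_image_of_injective (zPathQubits b₀ n ω) zbond_injective, image_zbond_zPathQubits hX,
    Finset.card_image_of_injOn (zPathEdge_injOn hω b₀), Finset.card_range]

open Classical in
/-- Sums over the qubits of the path are sums over its bonds. [cite: DennisEtAl2002, §5.2] -/
theorem sum_zPathQubits_eq {M : Type*} [AddCommMonoid M] {b₀ : Fin L} {n : ℕ} {ω : ℕ → Site 2}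
    (hω : ω ∈ saws 2 n) (hX : IsZCrossing L b₀ n ω) (g : Sym2 (Site 2) → M) :
    ∑ q ∈ zPathQubits b₀ n ω, g (zbond q) = ∑ i ∈ Finset.range n, g (zPathEdge b₀ ω i) := by
  rw [← Finset.sum_image (fun q _ q' _ h => zbond_injective h), image_zbond_zPathQubits hX,
    Finset.sum_image (zPathEdge_injOn hω b₀)]

/-- Telescoping modulo `2`. [folklore] -/
private theorem sum_range_add_succ_eqZ (f : ℕ → ZMod 2) (n : ℕ) :
    ∑ i ∈ Finset.range n, (f i + f (i + 1)) = f 0 + f n := by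
  have h2 : ∀ x : ZMod 2, x + x = 0 := by decide
  induction n with
  | zero => rw [Finset.sum_range_zero, h2]
  | succ n ih =>
    rw [Finset.sum_range_succ, ih]
    calc f 0 + f n + (f n + f (n + 1)) = f 0 + f (n + 1) + (f n + f n) := by ring
      _ = f 0 + f (n + 1) := by rw [h2, add_zero]

/-- **A rough-to-rough path carries no syndrome**: `H_Z 𝟙_P = 0` for the qubit set `P` of a crossing self-avoiding path (every
valid face is met by `0` or `2` of its bonds, the two ends being virtual; invalid faces are zero rows).
[cite: DennisEtAl2002, §3.2 (a relative 1-cycle ending on the rough edges has no boundary)] -/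
theorem HZ_mulVec_zPathQubits {b₀ : Fin L} {n : ℕ} {ω : ℕ → Site 2} (hω : ω ∈ saws 2 n) (hX : IsZCrossing L b₀ n ω)
    {χ : Fin L × Fin L → ZMod 2} (hχ : ∀ q, χ q = if q ∈ zPathQubits b₀ n ω then 1 else 0) : HZ L *ᵥ χ = 0 := by
  classical
  have hL : 1 ≤ L := Nat.one_le_iff_ne_zero.2 fun h => by subst h; exact Fin.elim0 b₀
  obtain ⟨h0, -, hadj, -⟩ := mem_saws.1 hω
  obtain ⟨b₁, hb₁⟩ := hX.2
  funext x
  rw [Pi.zero_apply]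
  by_cases hx : (x.1.val + x.2.val) % 2 = 0
  swap
  · have hrow : HZ L x = 0 := HZ_eq_zero_of_invalid x hx
    simp only [Matrix.mulVec, dotProduct, hrow, Pi.zero_apply, zero_mul, Finset.sum_const_zero]
  rw [HZ_mulVec_apply_eq_sum_of_valid hx]
  set v : Site 2 := zsite x with hv
  set f : ℕ → ZMod 2 := fun i => if v = vbotZ b₀ + ω i then 1 else 0 with hf
  have h1 : (∑ q, if v ∈ zbond q then χ q else 0) =
      ∑ q ∈ zPathQubits b₀ n ω, if v ∈ zbond q then (1 : ZMod 2) else 0 := by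
    rw [← Fintype.sum_extend_by_zero (zPathQubits b₀ n ω)]
    refine Finset.sum_congr rfl fun q _ => ?_
    rw [hχ q]
    split_ifs <;> rfl
  have h2 : ∀ i ∈ Finset.range n, (if v ∈ zPathEdge b₀ ω i then (1 : ZMod 2) else 0) = f i + f (i + 1) := by
    intro i hi
    rw [Finset.mem_range] at hi
    have hne : vbotZ b₀ + ω i ≠ vbotZ b₀ + ω (i + 1) := fun h => (hadj i hi).ne (add_left_cancel h)
    simp only [zPathEdge, Sym2.mem_iff, hf]
    by_cases hA : v = vbotZ b₀ + ω i
    · rw [if_pos (Or.inl hA), if_pos hA, if_neg (fun h => hne (hA.symm.trans h)), add_zero]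
    · by_cases hB : v = vbotZ b₀ + ω (i + 1)
      · rw [if_pos (Or.inr hB), if_neg hA, if_pos hB, zero_add]
      · rw [if_neg (not_or.2 ⟨hA, hB⟩), if_neg hA, if_neg hB, add_zero]
  have hxd := zsite_sub_eq hx
  have h3 : f 0 = 0 := by
    simp only [hf, h0, add_zero]
    rw [if_neg]
    intro h
    have := vbotZ_sub b₀
    rw [← h, hv] at this
    omega
  have h4 : f n = 0 := by
    simp only [hf, hb₁]
    rw [if_neg]
    intro h
    have := vtopZ_sub hL b₁
    rw [← h, hv] at this
    have := x.1.2
    omega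
  rw [h1, sum_zPathQubits_eq hω hX (fun e => if v ∈ e then (1 : ZMod 2) else 0), Finset.sum_congr rfl h2,
    sum_range_add_succ_eqZ, h3, h4, add_zero]

/-- **A rough-to-rough path has at least `L` bonds** (`u - v` climbs from `-1` to `L - 1`).
[cite: DennisEtAl2002, §5.2 ("homologically nontrivial (self-avoiding) path must contain at least L links")] -/
theorem le_length_of_isZCrossing {b₀ : Fin L} {n : ℕ} {ω : ℕ → Site 2} (hω : ω ∈ saws 2 n) (hX : IsZCrossing L b₀ n ω) :
    L ≤ n := by
  have hL : 1 ≤ L := Nat.one_le_iff_ne_zero.2 fun h => by subst h; exact Fin.elim0 b₀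
  obtain ⟨h0, -, hadj, -⟩ := mem_saws.1 hω
  obtain ⟨b₁, hb₁⟩ := hX.2
  have hb := abs_sub_coord_leZ h0 hadj n le_rfl
  have e0 := congrFun hb₁ 0
  have e1 := congrFun hb₁ 1
  simp only [Pi.add_apply] at e0 e1
  have hvb := vbotZ_sub b₀
  have hvt := vtopZ_sub hL b₁
  have hωn : ω n 0 - ω n 1 = (L : ℤ) := by linarith
  rw [hωn] at hb
  have := le_of_abs_le hb
  omega

/-! ### Extraction -/

/-- ★ **For `L ≥ 2`, a cycle of the sector with an odd number of row-`0` qubits contains a rough-to-rough self-avoiding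
path** whose qubits lie in any set `Er` supporting the cycle (hand-shaking lemma + Mathlib's `Walk.bypass`, read as an
`n`-step self-avoiding walk of `ℤ²` from its start). [cite: DennisEtAl2002, §5.3 (relative polygons stretching from one edge to the opposite edge)] -/
theorem rsc_existsZ_crossing_subset (hL : 2 ≤ L) {Er : Finset (Fin L × Fin L)} {c : Fin L × Fin L → ZMod 2}
    (hc : HZ L *ᵥ c = 0) (hcE : ∀ q, c q ≠ 0 → q ∈ Er) (hodd : ∑ j : Fin L, c (⟨0, by omega⟩, j) = 1) :
    ∃ (b₀ : Fin L) (n : ℕ) (ω : ℕ → Site 2), ω ∈ saws 2 n ∧ IsZCrossing L b₀ n ω ∧ zPathQubits b₀ n ω ⊆ Er := by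
  classical
  obtain ⟨b₀, b₁, hreach⟩ := rsc_existsZ_reachable_top_of_odd hL hc hcE hodd
  obtain ⟨W⟩ := hreach
  set s : Site 2 := vbotZ b₀ with hs
  set t : Site 2 := vtopZ b₁ with ht
  set P : (openGraph (rscLiftZ Er)).Walk s t := W.bypass with hP
  have hpath : P.IsPath := W.bypass_isPath
  set n := P.length with hn
  set ω : ℕ → Site 2 := fun i => P.getVert i - s with hω
  have hωs : ∀ i, s + ω i = P.getVert i := fun i => by
    simp only [hω]; abel
  have hstep : ∀ i < n, ∃ q ∈ Er, zbond q = zPathEdge b₀ ω i := by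
    intro i hi
    have hA := P.adj_getVert_succ hi
    rw [openGraph_adj] at hA
    obtain ⟨⟨q, hq, hqe⟩, -⟩ := hA
    refine ⟨q, hq, ?_⟩
    rw [hqe, zPathEdge, ← hs, hωs, hωs]
  refine ⟨b₀, n, ω, ?_, ⟨fun i hi => ?_, b₁, ?_⟩, fun q hq => ?_⟩
  · refine mem_saws.2 ⟨by simp [hω], fun i hi => ?_, fun i hi => ?_, fun i hi j hj hij => ?_⟩
    · simp only [hω]
      rw [P.getVert_of_length_le hi, P.getVert_length]
    · obtain ⟨q, -, hq⟩ := hstep i hi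
      have hA := zdGraph_adj_of_zbond_eq q hq
      rwa [← zdGraph_adj_sub_right _ _ s, add_sub_cancel_left, add_sub_cancel_left] at hA
    · exact hpath.getVert_injOn hi hj (sub_left_injective hij)
  · obtain ⟨q, -, hq⟩ := hstep i hi
    exact ⟨q, hq⟩
  · rw [hωs, P.getVert_of_length_le le_rfl]
  · rw [zPathQubits, Finset.mem_filter] at hq
    obtain ⟨i, hi, hqi⟩ := hq.2
    obtain ⟨q', hq', hq'i⟩ := hstep i hi
    rwa [← zbond_injective (hqi.trans hq'i.symm)] at hq'

end RotatedSurface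

end Literature.InformationTheory.QuantumCodes
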